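import Summits.KontsevichZagierPeriods.KontsevichZagierPeriods.Theses.FurushoPentagon

/-!
# Sketch — first lemmas of the three crux-idea cards for `PentagonInKZ` (stmt-KontsevichZagierPeriods-11348)

Planner sketch (crux-ideate round 1, ideator 3). Nothing here is proved; every `def … : Prop` must
elaborate over existing declarations. Cards: `Ideas/convergent-generators.md` (HalfPointFactorisation),
`Ideas/difference-form-newton-leibniz.md` (SubtractedFaceAtom), `Ideas/generic-fibre-specialisation.md`
(DyadicLogClasses).
-/

noncomputable section

open Set
open Literature.NumberTheory.Transcendental

namespace Summit.KontsevichZagierPeriods.KontsevichZagierPeriods.Cruxes.PentagonInKZ.IdeaSketch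

/-! ## Card 1 — convergent generators / half-point factorisation -/

/-- The iterated-integral integrand `∏ᵢ ω_{vᵢ}(tᵢ)` of a binary word (`false` = `dt/t`,
`true` = `dt/(1-t)`), letters read from the top variable `t₀` down. [folklore] -/
def wordIntegrand (v : List Bool) (t : Fin v.length → ℝ) : ℝ :=
  ∏ i : Fin v.length, KZ.mzvForm (v.getD i false) (t i)

/-- The lower truncated ordered simplex `{z > t₀ > ⋯ > t_{k-1} > 0}`. [folklore] -/
def lowerSimplex (z : ℚ) (k : ℕ) : Set (Fin k → ℝ) :=
  {t | (∀ i, 0 < t i) ∧ (∀ i, t i < (z : ℝ)) ∧ StrictAnti t}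

/-- The upper truncated ordered simplex `{1 > t₀ > ⋯ > t_{k-1} > z}`. [folklore] -/
def upperSimplex (z : ℚ) (k : ℕ) : Set (Fin k → ℝ) :=
  {t | (∀ i, (z : ℝ) < t i) ∧ (∀ i, t i < 1) ∧ StrictAnti t}

/-- `L` assigns to every word WITHOUT trailing `x` (= convergent at `0`) the class of an honest
representation on the lower simplex (start-anchored at the tangential base point `0`, cut at `z`). -/
def ReadsLower (z : ℚ) (L : List Bool → KZ.FormalRep) : Prop :=
  ∀ v : List Bool, v.getLast? ≠ some false →
    ∃ r : KZ.IntegralRep v.length, r.domain = lowerSimplex z v.length ∧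
      EqOn r.integrand (wordIntegrand v) r.domain ∧ L v = KZ.of r

/-- `U` assigns to every word WITHOUT leading `y` (= convergent at `1`) the class of an honest
representation on the upper simplex. -/
def ReadsUpper (z : ℚ) (U : List Bool → KZ.FormalRep) : Prop :=
  ∀ v : List Bool, v.head? ≠ some true →
    ∃ r : KZ.IntegralRep v.length, r.domain = upperSimplex z v.length ∧
      EqOn r.integrand (wordIntegrand v) r.domain ∧ U v = KZ.of r

/-- A class of `∫_z^1 dt/t = log(1/z)`. -/
def IsUpperLog (z : ℚ) (ℓ : KZ.FormalRep) : Prop :=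
  ∃ r : KZ.IntegralRep 1, r.domain = {t | (z : ℝ) < t 0 ∧ t 0 < 1} ∧
    EqOn r.integrand (fun t => 1 / t 0) r.domain ∧ ℓ = KZ.of r

/-- A class of `∫_0^z dt/(1-t) = -log(1-z)`. -/
def IsLowerLog (z : ℚ) (m : KZ.FormalRep) : Prop :=
  ∃ r : KZ.IntegralRep 1, r.domain = {t | 0 < t 0 ∧ t 0 < (z : ℝ)} ∧
    EqOn r.integrand (fun t => 1 / (1 - t 0)) r.domain ∧ m = KZ.of r

variable {R : Type} [CommRing R] [Algebra ℚ R]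

/-- The χ-valued shuffle-regularised MZV series of the crux (VERBATIM the series inside
`FurushoPentagon.PentagonInKZ`). -/
def phiChi (χ : KZ.FormalRep →+ R) (Z : List ℕ → KZ.FormalRep) : NCSeries Bool R :=
  fun W : List Bool => (-1 : R) ^ (W.count true) *
    (MZV.shuffleReg W).sum (fun v a => a • (if MZV.IsConvergentWord v then χ (Z (MZV.ofBinaryWord v)) else (0 : R)))

/-- Finite part of the transport from the tangential base point `0` to `z`: IKZ's `regEnd`
(kills trailing `x`) evaluated on the honest lower classes. -/
def G0fin (χ : KZ.FormalRep →+ R) (L : List Bool → KZ.FormalRep) : NCSeries Bool R :=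
  fun W : List Bool => (-1 : R) ^ (W.count true) * (MZV.regEnd W).sum (fun v a => a • χ (L v))

/-- Finite part of the transport from `z` to the tangential base point `1`: `regFront` (kills
leading `y`) evaluated on the honest upper classes. -/
def H1fin (χ : KZ.FormalRep →+ R) (U : List Bool → KZ.FormalRep) : NCSeries Bool R :=
  fun W : List Bool => (-1 : R) ^ (W.count true) * (MZV.regFront W).sum (fun v a => a • χ (U v))

/-- **First lemma of card `convergent-generators` (HalfPointFactorisation).** For every realisation
χ of the rules, every rational cut point `z ∈ (0,1)`, every full simplex assignment `Z` (as in the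
crux) and all honest truncated assignments `L`, `U` and log classes `ℓ = [∫_z^1 dt/t]`,
`m = [∫_0^z dt/(1-t)]`, the crux's associator factorises EXACTLY over `R`:
`Φ_χ = (exp(χ m · X₁) · H₁ᶠⁱⁿ(z)) · (G₀ᶠⁱⁿ(z) · exp(−χ ℓ · X₀))`
— composition of paths at an interior point, with the two tangential base points costing only
the weight-one classes `ℓ`, `m` (Reutenauer factorisation of a group-like series; on the shuffle
generators = convergent Lyndon words it is the three-piece dissection of the simplex at `t = z`).
Not proved here. [cite: IharaKanekoZagier2006, Prop. 1 and Cor. 5] [cite: Furusho2003, Prop. 3.2.3] -/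
def HalfPointFactorisation : Prop :=
  ∀ (R : Type) [CommRing R] [Algebra ℚ R] (χ : KZ.FormalRep →+ R),
    (∀ c ∈ KZ.relations, χ c = 0) → (∀ a b : KZ.FormalRep, χ (a * b) = χ a * χ b) →
    (∃ u : KZ.FormalRep, χ u = 1) →
    ∀ (z : ℚ), 0 < z → z < 1 →
    ∀ Z : List ℕ → KZ.FormalRep,
      (∀ (u : List ℕ) (hu : MZV.IsAdmissible u), Z u = KZ.of (KZ.mzvRep u hu
        (KZ.mzvIntegrand_isSemialgebraicFunOn_holds u) (KZ.mzvIntegrand_integrableOn_holds u hu))) →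
    ∀ (L U : List Bool → KZ.FormalRep), ReadsLower z L → ReadsUpper z U →
    ∀ (ℓ m : KZ.FormalRep), IsUpperLog z ℓ → IsLowerLog z m →
      phiChi χ Z =
        (NCSeries.exp (χ m • (NCSeries.X₁ : NCSeries Bool R)) * H1fin χ U) *
          (G0fin χ L * NCSeries.exp ((-χ ℓ) • (NCSeries.X₀ : NCSeries Bool R)))

/-! ## Card 2 — difference-form Newton–Leibniz (native subtraction at a divergent face) -/

/-- **First lemma of card `difference-form-newton-leibniz` (SubtractedFaceAtom).** The corner atom
`∂_t V(bc)` of the isomonodromic identity for a start-regularised vertical transport, with the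
letters `b = dξ/ξ` and `c = dlog(2 + t + ξ t)`, at `(t, t') = (0, 1)`, `h = 1`:
`∫_{1>ξ₀>ξ₁>0} dξ / (ξ₀ (3 + ξ₁)) = ∫_{(0,1)²} 2 / ((2+s)(2+s+sξ)) ds dξ` (both `= −Li₂(−1/3)`),
as a KZ-equivalence. The intended chain is THREE moves: Newton–Leibniz in the parameter `s` on the
3-dimensional band (primitive = the integrand `(1/ξ₀) ∂_ξ log(2+s+ξ₁ s)` itself), the pointwise
identity `∂_s∂_ξ log = ∂_ξ∂_s log`, and Newton–Leibniz in `ξ₁ ∈ [0, ξ₀]` whose base term is the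
DIFFERENCE `(1/ξ₀)(g(ξ₀,s) − g(0,s))`, `g = ∂_s log(2+s+ξ s) = (1+ξ)/(2+s+ξ s)` — one absolutely
convergent representation although `∫ (1/ξ₀) g(ξ₀,s)` and `∫ (1/ξ₀) g(0,s)` diverge separately.
Not proved here. [cite: KontsevichZagier2001, §1.2 rule 3] -/
def SubtractedFaceAtom : Prop :=
  ∀ (r r' : KZ.IntegralRep 2),
    r.domain = {ξ | ξ 1 < ξ 0 ∧ ξ 0 < 1 ∧ 0 < ξ 1} →
    EqOn r.integrand (fun ξ => 1 / (ξ 0 * (3 + ξ 1))) r.domain →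
    r'.domain = {x | 0 < x 0 ∧ x 0 < 1 ∧ 0 < x 1 ∧ x 1 < 1} →
    EqOn r'.integrand (fun x => 2 / ((2 + x 0) * (2 + x 0 + x 0 * x 1))) r'.domain →
    KZ.Equivalent r r'

/-! ## Card 3 — generic fibre / specialisation: the dyadic log-separation atom -/

/-- **First lemma of card `generic-fibre-specialisation` (DyadicLogClasses).** Along the dyadic
sequence `ε = 2^{-k}` the counterterm classes are INTEGER multiples of one class:
`[∫_{2^{-k}}^1 dt/t] − k · [∫_{1/2}^1 dt/t] ∈ KZ.relations` (domain additivity at the points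
`2^{-j}` and the scaling changes of variables `t ↦ 2^{j} t`). This is what lets finite differences
in `k` separate the `[log ε]^j`-layers of a uniform-in-`ε` identity without deriving any
counterterm class independently. Not proved here. [cite: KontsevichZagier2001, §1.2 rules 1–2] -/
def DyadicLogClasses : Prop :=
  ∀ (k : ℕ) (r₁ rk : KZ.IntegralRep 1),
    r₁.domain = {t | (1 / 2 : ℝ) < t 0 ∧ t 0 < 1} → EqOn r₁.integrand (fun t => 1 / t 0) r₁.domain →
    rk.domain = {t | (1 / 2 : ℝ) ^ k < t 0 ∧ t 0 < 1} → EqOn rk.integrand (fun t => 1 / t 0) rk.domain →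
    KZ.of rk - (k : ℤ) • KZ.of r₁ ∈ KZ.relations

end Summit.KontsevichZagierPeriods.KontsevichZagierPeriods.Cruxes.PentagonInKZ.IdeaSketch
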